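import Literature.NumberTheory.Sieve.FriedlanderIwaniecPrimesJacobiTwistedVcmBound
import HarnessLib

/-!
# Friedlander–Iwaniec, *The polynomial `X² + Y⁴` captures its primes*, §12: the off-diagonal part
# `r₁ ≠ r₂` of the smoothed flipped form, reduced to the forms `V_{cm}` and bounded

[FI, §12, p. 50–51 of arXiv:math/9811185 = Ann. of Math. (2) 148 (1998), 945–1040]: "the
contribution of `r₁ = r₂` we estimate trivially … Now let `r₁ ≠ r₂`.  We put `r₁ = c t₁`, `r₂ = c t₂`
with `(t₁,t₂) = 1` … we remove the conditions `(t₁, dm) = (t₂, dm) = 1` by Möbius … obtaining forms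
`V_{cm}(f,g)` … `V_{cm}(f,g) ≪ {(cm)^{-1/2}(DHRS)^{1/2}(log 2RS)³ + [c^{-3/2}mD⁻¹(RS)^{3/2} + RS^{3/4}
 + SR^{3/4}](RS)^ε} ∑∑ τ(r)|α_{crs}|²`.  Summing over `m` and `c` we conclude …".

This file PROVES the off-diagonal estimate in summed form (`exists_norm_offDiag_le`): the
`r₁ ≠ r₂` part of the smoothed form equals `∑_{c ≤ R} ∑_{m ∣ c} μ(m) V_{cm}` (tree:
`sum_ne_eq_sum_gcd_moebius`), each `V_{cm}` with `c` odd is bounded by `exists_norm_flipForm_le`, and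
`V_{cm} = 0` for even `c` (the coefficients live on odd `r`).  The weights `∑_{c∣r}∑_{m∣c}` and the
choice of `H` are collected in the assembly of Proposition 12.1.  No definitions, no named facts
(HOME/parity-ideate-lit/FI98-Prop121-MAP.md, step D-g of the g26 addendum).

## References

* J. Friedlander, H. Iwaniec, *The polynomial `X² + Y⁴` captures its primes*, Ann. of Math. (2) 148
  (1998), 945–1040, §12, (12.9)–(12.17). [FriedlanderIwaniecAnnals1998]
-/

noncomputable section

open Finset Real Complex MeasureTheory
open scoped NumberTheorySymbols ArithmeticFunction.sigma ArithmeticFunction.Moebius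
  ComplexConjugate

namespace Literature.NumberTheory.Sieve.FriedlanderIwaniecPrimes

/-- **The off-diagonal part, reduced and bounded** [FI, §12, (12.9)–(12.17)]: for every
`0 < ε ≤ 1` there is `C > 0` such that for `R, S, D ≥ 1`, `N ≥ 4RS`, `N ≥ 3D`, coefficients `β`
supported on `(r, 2s) = 1` in one class modulo `4`, a weight `F` vanishing off `(1/2, 5/2)` with kernel
`M`, and a cutoff `g` (`= 0` off `(a, 3b)`, `a > 0`) with twisted-transform costs `≤ K(1+|t|)²L²`
(`K ≥ 0`),
`|∑_{d ≤ N} F(d/D) ∑∑_{r₁ ≠ r₂, d ∣ Δ} β₁β̄₂ (d/(r₁r₂)) g(|s₁/r₁ − s₂/r₂|)|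
  ≤ ∑_{c ≤ R} ∑_{m ∣ c} C(1 + log Q₂){(XS/√(mQ₁)·log 2R + XS) N_c + (mQ₂√(XS) + XS^{3/4} + SX^{3/4})(XS)^ε T_c}
      · K L² ∫(1+|t|)²|M|`,
`X = R/c`, `Q₁ = 2aR²/(5cD)`, `Q₂ = max(1, 24bR²/(cD))`, `N_c = ∑∑|β_{ct,s}|²`, `T_c = ∑∑τ(t)|β_{ct,s}|²`
over `R/c < t ≤ 2R/c`, `S < s ≤ 2S`. [cite: FriedlanderIwaniecAnnals1998, §12, (12.9)–(12.17)] -/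
theorem exists_norm_offDiag_le {ε : ℝ} (hε : 0 < ε) (hε1 : ε ≤ 1) :
    ∃ C : ℝ, 0 < C ∧ ∀ (R S D N : ℕ) (β : ℕ → ℕ → ℂ) (F : ℝ → ℝ) (M : ℝ → ℂ) (g : ℝ → ℝ)
      (a b K L : ℝ),
      1 ≤ R → 1 ≤ S → 1 ≤ D → 4 * R * S ≤ N → 3 * D ≤ N →
      (∀ r s, β r s ≠ 0 → r.Coprime (2 * s)) →
      (∀ r₁ s₁ r₂ s₂, β r₁ s₁ ≠ 0 → β r₂ s₂ ≠ 0 → r₁ % 4 = r₂ % 4) →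
      Continuous M → (∀ k : ℕ, Integrable (fun t : ℝ => |t| ^ k * ‖M t‖)) →
      (∀ w : ℝ, 0 < w → (F w : ℂ) = ∫ t : ℝ, M t * Complex.exp (2 * π * I * t * Real.log w)) →
      (∀ w, w ≤ 1 / 2 → F w = 0) → (∀ w, 5 / 2 ≤ w → F w = 0) →
      0 < a → (∀ x, x ≤ a → g x = 0) → (∀ x, 3 * b ≤ x → g x = 0) → 0 ≤ K →
      (∀ t : ℝ, ∃ Ĝ : ℝ → ℂ, Integrable Ĝ ∧ (∫ u, ‖Ĝ u‖) ≤ K * (1 + |t|) ^ 2 * L ^ 2 ∧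
        ∀ x : ℝ, ((g |x| : ℝ) : ℂ) * Complex.exp (2 * π * I * t * (Real.log |x| : ℝ)) =
          ∫ u, Ĝ u * Complex.exp (2 * π * I * u * x)) →
      ‖∑ d ∈ Ioc 0 N, (F ((d : ℝ) / D) : ℂ) *
          ∑ r₁ ∈ Ioc R (2 * R), ∑ s₁ ∈ Ioc S (2 * S), ∑ r₂ ∈ Ioc R (2 * R), ∑ s₂ ∈ Ioc S (2 * S),
            (if r₁ ≠ r₂ ∧ (d : ℤ) ∣ (r₁ : ℤ) * s₂ - (r₂ : ℤ) * s₁ then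
              β r₁ s₁ * conj (β r₂ s₂) * (J((d : ℤ) | r₁ * r₂) : ℂ) *
                (g |(s₁ : ℝ) / r₁ - (s₂ : ℝ) / r₂| : ℂ) else 0)‖ ≤
        ∑ c ∈ Icc 1 R, ∑ m ∈ c.divisors,
          C * (1 + Real.log (max 1 (24 * b * (R : ℝ) ^ 2 / (c * D)))) *
            (((R : ℝ) / c * S / Real.sqrt ((m : ℝ) * (2 * a * (R : ℝ) ^ 2 / (5 * c * D))) *
                  Real.log (2 * R) + (R : ℝ) / c * S) *
                (∑ t ∈ Ioc (R / c) (2 * R / c), ∑ s ∈ Ioc S (2 * S), ‖β (c * t) s‖ ^ 2) +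
              ((m : ℝ) * (max 1 (24 * b * (R : ℝ) ^ 2 / (c * D))) * Real.sqrt ((R : ℝ) / c * S) +
                  (R : ℝ) / c * (S : ℝ) ^ (3 / 4 : ℝ) + (S : ℝ) * ((R : ℝ) / c) ^ (3 / 4 : ℝ)) *
                ((R : ℝ) / c * S) ^ ε *
                (∑ t ∈ Ioc (R / c) (2 * R / c), ∑ s ∈ Ioc S (2 * S),
                  (σ 0 t : ℝ) * ‖β (c * t) s‖ ^ 2)) *
            (K * L ^ 2 * ∫ t : ℝ, (1 + |t|) ^ 2 * ‖M t‖) := by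
  obtain ⟨C, hC, hV⟩ := exists_norm_flipForm_le hε hε1
  refine ⟨C, hC, ?_⟩
  intro R S D N β F M g a b K L hR hS hD hN hN3 hβ hβ4 hMc hMi hFM hF3 hF4 ha hga hgb hK hĜ
  have hD0 : 0 < D := hD
  have hg00 : g 0 = 0 := hga 0 ha.le
  -- support consequences
  have hβodd : ∀ r s, β r s ≠ 0 → Odd r := by
    intro r s h
    have h2 : r.Coprime 2 := Nat.Coprime.coprime_dvd_right (dvd_mul_right 2 s) (hβ r s h)
    exact Nat.coprime_two_right.mp h2
  -- the guarded test function
  set Φ : ℕ → ℕ → ℕ → ℕ → ℂ := fun r₁ s₁ r₂ s₂ => β r₁ s₁ * conj (β r₂ s₂) *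
    (if (r₁ : ℤ) * s₂ - (r₂ : ℤ) * s₁ = 0 then (0 : ℂ) else
      (g |(s₁ : ℝ) / r₁ - (s₂ : ℝ) / r₂| : ℂ)) with hΦ
  -- Step 1: rewrite the summand as `J · Φ`
  have h1 : ∑ d ∈ Ioc 0 N, (F ((d : ℝ) / D) : ℂ) *
      ∑ r₁ ∈ Ioc R (2 * R), ∑ s₁ ∈ Ioc S (2 * S), ∑ r₂ ∈ Ioc R (2 * R), ∑ s₂ ∈ Ioc S (2 * S),
        (if r₁ ≠ r₂ ∧ (d : ℤ) ∣ (r₁ : ℤ) * s₂ - (r₂ : ℤ) * s₁ then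
          β r₁ s₁ * conj (β r₂ s₂) * (J((d : ℤ) | r₁ * r₂) : ℂ) *
            (g |(s₁ : ℝ) / r₁ - (s₂ : ℝ) / r₂| : ℂ) else 0) =
      ∑ d ∈ Ioc 0 N, (fun d : ℕ => (F ((d : ℝ) / D) : ℂ)) d *
      ∑ r₁ ∈ Ioc R (2 * R), ∑ s₁ ∈ Ioc S (2 * S), ∑ r₂ ∈ Ioc R (2 * R), ∑ s₂ ∈ Ioc S (2 * S),
        (if r₁ ≠ r₂ ∧ (d : ℤ) ∣ (r₁ : ℤ) * s₂ - (r₂ : ℤ) * s₁ then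
          (J((d : ℤ) | r₁ * r₂) : ℂ) * Φ r₁ s₁ r₂ s₂ else 0) := by
    refine sum_congr rfl fun d _ => ?_
    congr 1
    refine sum_congr rfl fun r₁ hr₁ => sum_congr rfl fun s₁ _ => sum_congr rfl fun r₂ hr₂ =>
      sum_congr rfl fun s₂ _ => ?_
    split_ifs with h
    · rw [hΦ]
      simp only
      by_cases hΔ : (r₁ : ℤ) * s₂ - (r₂ : ℤ) * s₁ = 0
      · rw [if_pos hΔ]
        have hr₁0 : (0 : ℝ) < r₁ := by exact_mod_cast lt_of_le_of_lt (Nat.zero_le _) (mem_Ioc.mp hr₁).1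
        have hr₂0 : (0 : ℝ) < r₂ := by exact_mod_cast lt_of_le_of_lt (Nat.zero_le _) (mem_Ioc.mp hr₂).1
        have hx : (s₁ : ℝ) / r₁ - (s₂ : ℝ) / r₂ = 0 := by
          have hΔr : (r₁ : ℝ) * s₂ - (r₂ : ℝ) * s₁ = 0 := by exact_mod_cast hΔ
          field_simp
          linarith
        rw [hx, abs_zero, hg00]
        simp
      · rw [if_neg hΔ]
        ring
    · rfl
  -- Step 2: the `gcd`/Möbius reduction
  have hw : ∀ d, N < d → (fun d : ℕ => (F ((d : ℝ) / D) : ℂ)) d = 0 := by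
    intro d hd
    have hD0' : (0 : ℝ) < D := by exact_mod_cast hD0
    have h52 : (5 : ℝ) / 2 ≤ (d : ℝ) / D := by
      rw [le_div_iff₀ hD0']
      have : ((3 * D : ℕ) : ℝ) < d := by exact_mod_cast lt_of_le_of_lt hN3 hd
      push_cast at this
      linarith
    simp only [hF4 _ h52, Complex.ofReal_zero]
  have h2 := sum_ne_eq_sum_gcd_moebius R S N (fun d : ℕ => (F ((d : ℝ) / D) : ℂ)) hw Φ
  rw [h1, h2]
  -- Step 3: triangle inequality over `c, m`, `|μ| ≤ 1`, and the bound for each `V_{cm}`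
  refine (norm_sum_le _ _).trans (sum_le_sum fun c hc => ?_)
  refine (norm_sum_le _ _).trans (sum_le_sum fun m hm => ?_)
  have hc1 : 1 ≤ c := (mem_Icc.mp hc).1
  have hcR : c ≤ R := (mem_Icc.mp hc).2
  have hc0 : 0 < c := hc1
  have hm0 : 0 < m := Nat.pos_of_mem_divisors hm
  rw [norm_mul]
  have hμ : ‖(μ m : ℂ)‖ ≤ 1 := by
    rw [Complex.norm_intCast]
    exact_mod_cast ArithmeticFunction.abs_moebius_le_one
  -- nonnegativity of the bound
  have hS0 : (0 : ℝ) ≤ S := Nat.cast_nonneg S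
  have hX0 : 0 ≤ (R : ℝ) / c := by positivity
  have hQ₂1 : (1 : ℝ) ≤ max 1 (24 * b * (R : ℝ) ^ 2 / (c * D)) := le_max_left _ _
  have hlogR : 0 ≤ Real.log (2 * R) := Real.log_nonneg (by
    have : (1 : ℝ) ≤ R := by exact_mod_cast hR
    linarith)
  have hIM : 0 ≤ ∫ t : ℝ, (1 + |t|) ^ 2 * ‖M t‖ :=
    integral_nonneg fun t => mul_nonneg (by positivity) (norm_nonneg _)
  have hBound0 : 0 ≤ C * (1 + Real.log (max 1 (24 * b * (R : ℝ) ^ 2 / (c * D)))) *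
      (((R : ℝ) / c * S / Real.sqrt ((m : ℝ) * (2 * a * (R : ℝ) ^ 2 / (5 * c * D))) *
            Real.log (2 * R) + (R : ℝ) / c * S) *
          (∑ t ∈ Ioc (R / c) (2 * R / c), ∑ s ∈ Ioc S (2 * S), ‖β (c * t) s‖ ^ 2) +
        ((m : ℝ) * (max 1 (24 * b * (R : ℝ) ^ 2 / (c * D))) * Real.sqrt ((R : ℝ) / c * S) +
            (R : ℝ) / c * (S : ℝ) ^ (3 / 4 : ℝ) + (S : ℝ) * ((R : ℝ) / c) ^ (3 / 4 : ℝ)) *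
          ((R : ℝ) / c * S) ^ ε *
          (∑ t ∈ Ioc (R / c) (2 * R / c), ∑ s ∈ Ioc S (2 * S), (σ 0 t : ℝ) * ‖β (c * t) s‖ ^ 2)) *
      (K * L ^ 2 * ∫ t : ℝ, (1 + |t|) ^ 2 * ‖M t‖) := by
    refine mul_nonneg (mul_nonneg (mul_nonneg hC.le (by linarith [Real.log_nonneg hQ₂1]))
      (add_nonneg ?_ ?_)) (mul_nonneg (mul_nonneg hK (sq_nonneg L)) hIM)
    · exact mul_nonneg (add_nonneg (mul_nonneg (div_nonneg (mul_nonneg hX0 hS0)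
        (Real.sqrt_nonneg _)) hlogR) (mul_nonneg hX0 hS0))
        (sum_nonneg fun _ _ => sum_nonneg fun _ _ => sq_nonneg _)
    · exact mul_nonneg (mul_nonneg (add_nonneg (add_nonneg (mul_nonneg (mul_nonneg
        (Nat.cast_nonneg m) (by linarith)) (Real.sqrt_nonneg _))
        (mul_nonneg hX0 (Real.rpow_nonneg hS0 _))) (mul_nonneg hS0 (Real.rpow_nonneg hX0 _)))
        (Real.rpow_nonneg (mul_nonneg hX0 hS0) _))
        (sum_nonneg fun _ _ => sum_nonneg fun _ _ => mul_nonneg (Nat.cast_nonneg _) (sq_nonneg _))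
  rcases Nat.even_or_odd c with hce | hco
  · -- even `c`: every term vanishes since `β` lives on odd `r`
    have hz : ∑ d ∈ Ioc 0 N, (fun d : ℕ => (F ((d : ℝ) / D) : ℂ)) (d * m) *
        ∑ t₁ ∈ Ioc (R / c) (2 * R / c), ∑ s₁ ∈ Ioc S (2 * S), ∑ t₂ ∈ Ioc (R / c) (2 * R / c),
          ∑ s₂ ∈ Ioc S (2 * S),
          (if ((d * m : ℕ) : ℤ) ∣ (t₁ : ℤ) * s₂ - (t₂ : ℤ) * s₁ ∧ t₁.Coprime t₂ then
            (J(((d * m : ℕ) : ℤ) | t₁ * t₂) : ℂ) * Φ (c * t₁) s₁ (c * t₂) s₂ else 0) = 0 := by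
      refine sum_eq_zero fun d _ => ?_
      rw [mul_eq_zero]; right
      refine sum_eq_zero fun t₁ _ => sum_eq_zero fun s₁ _ => sum_eq_zero fun t₂ _ =>
        sum_eq_zero fun s₂ _ => ?_
      split_ifs
      · have hβ0 : β (c * t₁) s₁ = 0 := by
          by_contra h
          exact (Nat.not_even_iff_odd.mpr (hβodd _ _ h)) (hce.mul_right t₁)
        simp [hΦ, hβ0]
      · rfl
    rw [hz, norm_zero, mul_zero]
    exact hBound0
  · -- odd `c`: this is `V_{cm}` as bounded in `exists_norm_flipForm_le`
    have hVcm := hV R S D c m N β F M g a b K L hR hS hD hc1 hcR hco hm0 hN hβ hβ4 hMc hMi hFM hF3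
      hF4 hg00 ha hga hgb hĜ
    -- identify the two inner forms (guard in `t`- vs `r`-variables; casts of `c t`)
    have hid : ∑ d ∈ Ioc 0 N, (fun d : ℕ => (F ((d : ℝ) / D) : ℂ)) (d * m) *
        ∑ t₁ ∈ Ioc (R / c) (2 * R / c), ∑ s₁ ∈ Ioc S (2 * S), ∑ t₂ ∈ Ioc (R / c) (2 * R / c),
          ∑ s₂ ∈ Ioc S (2 * S),
          (if ((d * m : ℕ) : ℤ) ∣ (t₁ : ℤ) * s₂ - (t₂ : ℤ) * s₁ ∧ t₁.Coprime t₂ then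
            (J(((d * m : ℕ) : ℤ) | t₁ * t₂) : ℂ) * Φ (c * t₁) s₁ (c * t₂) s₂ else 0) =
      ∑ d ∈ Ioc 0 N, (F (((d * m : ℕ) : ℝ) / D) : ℂ) *
        ∑ t₁ ∈ Ioc (R / c) (2 * R / c), ∑ s₁ ∈ Ioc S (2 * S), ∑ t₂ ∈ Ioc (R / c) (2 * R / c),
          ∑ s₂ ∈ Ioc S (2 * S),
          (if ((d * m : ℕ) : ℤ) ∣ (t₁ : ℤ) * s₂ - (t₂ : ℤ) * s₁ ∧ t₁.Coprime t₂ then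
            (J(((d * m : ℕ) : ℤ) | t₁ * t₂) : ℂ) *
              (β (c * t₁) s₁ * conj (β (c * t₂) s₂) *
                (if (t₁ : ℤ) * s₂ - (t₂ : ℤ) * s₁ = 0 then (0 : ℂ) else
                  (g |(s₁ : ℝ) / (c * t₁) - (s₂ : ℝ) / (c * t₂)| : ℂ))) else 0) := by
      refine sum_congr rfl fun d _ => ?_
      congr 1
      refine sum_congr rfl fun t₁ _ => sum_congr rfl fun s₁ _ => sum_congr rfl fun t₂ _ =>
        sum_congr rfl fun s₂ _ => ?_
      have hguard : ((c * t₁ : ℕ) : ℤ) * s₂ - ((c * t₂ : ℕ) : ℤ) * s₁ = 0 ↔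
          (t₁ : ℤ) * s₂ - (t₂ : ℤ) * s₁ = 0 := by
        have hc0' : (c : ℤ) ≠ 0 := by exact_mod_cast hc0.ne'
        constructor
        · intro h0
          push_cast at h0
          have : (c : ℤ) * ((t₁ : ℤ) * s₂ - (t₂ : ℤ) * s₁) = 0 := by linear_combination h0
          exact (mul_eq_zero.mp this).resolve_left hc0'
        · intro h0
          push_cast
          linear_combination (c : ℤ) * h0
      have hcast : |(s₁ : ℝ) / ((c * t₁ : ℕ) : ℝ) - (s₂ : ℝ) / ((c * t₂ : ℕ) : ℝ)| =
          |(s₁ : ℝ) / (c * t₁) - (s₂ : ℝ) / (c * t₂)| := by push_cast; ring_nf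
      split_ifs with h hΔ
      · rw [hΦ]
        simp only
        rw [if_pos (hguard.mpr hΔ)]
      · rw [hΦ]
        simp only
        rw [if_neg (fun h0 => hΔ (hguard.mp h0)), hcast]
      · rfl
    rw [hid]
    calc ‖(μ m : ℂ)‖ * _ ≤ 1 * _ := mul_le_mul_of_nonneg_right hμ (norm_nonneg _)
      _ = _ := one_mul _
      _ ≤ _ := hVcm

/-- **The off-diagonal part, reduced and bounded, sharp `q = 1` term** [FI, §12, (12.9)–(12.17)]:
as `exists_norm_offDiag_le` with the block-free modulus charged `XS/√Q₁` (via
`exists_norm_flipForm_le'`): for every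
`0 < ε ≤ 1` there is `C > 0` such that for `R, S, D ≥ 1`, `N ≥ 4RS`, `N ≥ 3D`, coefficients `β`
supported on `(r, 2s) = 1` in one class modulo `4`, a weight `F` vanishing off `(1/2, 5/2)` with kernel
`M`, and a cutoff `g` (`= 0` off `(a, 3b)`, `a > 0`) with twisted-transform costs `≤ K(1+|t|)²L²`
(`K ≥ 0`),
`|∑_{d ≤ N} F(d/D) ∑∑_{r₁ ≠ r₂, d ∣ Δ} β₁β̄₂ (d/(r₁r₂)) g(|s₁/r₁ − s₂/r₂|)|
  ≤ ∑_{c ≤ R} ∑_{m ∣ c} C(1 + log Q₂){(XS/√(mQ₁)·log 2R + XS/√Q₁) N_c + (mQ₂√(XS) + XS^{3/4} + SX^{3/4})(XS)^ε T_c}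
      · K L² ∫(1+|t|)²|M|`,
`X = R/c`, `Q₁ = 2aR²/(5cD)`, `Q₂ = max(1, 24bR²/(cD))`, `N_c = ∑∑|β_{ct,s}|²`, `T_c = ∑∑τ(t)|β_{ct,s}|²`
over `R/c < t ≤ 2R/c`, `S < s ≤ 2S`. [cite: FriedlanderIwaniecAnnals1998, §12, (12.9)–(12.17)] -/
theorem exists_norm_offDiag_le' {ε : ℝ} (hε : 0 < ε) (hε1 : ε ≤ 1) :
    ∃ C : ℝ, 0 < C ∧ ∀ (R S D N : ℕ) (β : ℕ → ℕ → ℂ) (F : ℝ → ℝ) (M : ℝ → ℂ) (g : ℝ → ℝ)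
      (a b K L : ℝ),
      1 ≤ R → 1 ≤ S → 1 ≤ D → 4 * R * S ≤ N → 3 * D ≤ N →
      (∀ r s, β r s ≠ 0 → r.Coprime (2 * s)) →
      (∀ r₁ s₁ r₂ s₂, β r₁ s₁ ≠ 0 → β r₂ s₂ ≠ 0 → r₁ % 4 = r₂ % 4) →
      Continuous M → (∀ k : ℕ, Integrable (fun t : ℝ => |t| ^ k * ‖M t‖)) →
      (∀ w : ℝ, 0 < w → (F w : ℂ) = ∫ t : ℝ, M t * Complex.exp (2 * π * I * t * Real.log w)) →
      (∀ w, w ≤ 1 / 2 → F w = 0) → (∀ w, 5 / 2 ≤ w → F w = 0) →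
      0 < a → (∀ x, x ≤ a → g x = 0) → (∀ x, 3 * b ≤ x → g x = 0) → 0 ≤ K →
      (∀ t : ℝ, ∃ Ĝ : ℝ → ℂ, Integrable Ĝ ∧ (∫ u, ‖Ĝ u‖) ≤ K * (1 + |t|) ^ 2 * L ^ 2 ∧
        ∀ x : ℝ, ((g |x| : ℝ) : ℂ) * Complex.exp (2 * π * I * t * (Real.log |x| : ℝ)) =
          ∫ u, Ĝ u * Complex.exp (2 * π * I * u * x)) →
      ‖∑ d ∈ Ioc 0 N, (F ((d : ℝ) / D) : ℂ) *
          ∑ r₁ ∈ Ioc R (2 * R), ∑ s₁ ∈ Ioc S (2 * S), ∑ r₂ ∈ Ioc R (2 * R), ∑ s₂ ∈ Ioc S (2 * S),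
            (if r₁ ≠ r₂ ∧ (d : ℤ) ∣ (r₁ : ℤ) * s₂ - (r₂ : ℤ) * s₁ then
              β r₁ s₁ * conj (β r₂ s₂) * (J((d : ℤ) | r₁ * r₂) : ℂ) *
                (g |(s₁ : ℝ) / r₁ - (s₂ : ℝ) / r₂| : ℂ) else 0)‖ ≤
        ∑ c ∈ Icc 1 R, ∑ m ∈ c.divisors,
          C * (1 + Real.log (max 1 (24 * b * (R : ℝ) ^ 2 / (c * D)))) *
            (((R : ℝ) / c * S / Real.sqrt ((m : ℝ) * (2 * a * (R : ℝ) ^ 2 / (5 * c * D))) *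
                  Real.log (2 * R) + (R : ℝ) / c * S / Real.sqrt (2 * a * (R : ℝ) ^ 2 / (5 * c * D))) *
                (∑ t ∈ Ioc (R / c) (2 * R / c), ∑ s ∈ Ioc S (2 * S), ‖β (c * t) s‖ ^ 2) +
              ((m : ℝ) * (max 1 (24 * b * (R : ℝ) ^ 2 / (c * D))) * Real.sqrt ((R : ℝ) / c * S) +
                  (R : ℝ) / c * (S : ℝ) ^ (3 / 4 : ℝ) + (S : ℝ) * ((R : ℝ) / c) ^ (3 / 4 : ℝ)) *
                ((R : ℝ) / c * S) ^ ε *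
                (∑ t ∈ Ioc (R / c) (2 * R / c), ∑ s ∈ Ioc S (2 * S),
                  (σ 0 t : ℝ) * ‖β (c * t) s‖ ^ 2)) *
            (K * L ^ 2 * ∫ t : ℝ, (1 + |t|) ^ 2 * ‖M t‖) := by
  obtain ⟨C, hC, hV⟩ := exists_norm_flipForm_le' hε hε1
  refine ⟨C, hC, ?_⟩
  intro R S D N β F M g a b K L hR hS hD hN hN3 hβ hβ4 hMc hMi hFM hF3 hF4 ha hga hgb hK hĜ
  have hD0 : 0 < D := hD
  have hg00 : g 0 = 0 := hga 0 ha.le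
  -- support consequences
  have hβodd : ∀ r s, β r s ≠ 0 → Odd r := by
    intro r s h
    have h2 : r.Coprime 2 := Nat.Coprime.coprime_dvd_right (dvd_mul_right 2 s) (hβ r s h)
    exact Nat.coprime_two_right.mp h2
  -- the guarded test function
  set Φ : ℕ → ℕ → ℕ → ℕ → ℂ := fun r₁ s₁ r₂ s₂ => β r₁ s₁ * conj (β r₂ s₂) *
    (if (r₁ : ℤ) * s₂ - (r₂ : ℤ) * s₁ = 0 then (0 : ℂ) else
      (g |(s₁ : ℝ) / r₁ - (s₂ : ℝ) / r₂| : ℂ)) with hΦ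
  -- Step 1: rewrite the summand as `J · Φ`
  have h1 : ∑ d ∈ Ioc 0 N, (F ((d : ℝ) / D) : ℂ) *
      ∑ r₁ ∈ Ioc R (2 * R), ∑ s₁ ∈ Ioc S (2 * S), ∑ r₂ ∈ Ioc R (2 * R), ∑ s₂ ∈ Ioc S (2 * S),
        (if r₁ ≠ r₂ ∧ (d : ℤ) ∣ (r₁ : ℤ) * s₂ - (r₂ : ℤ) * s₁ then
          β r₁ s₁ * conj (β r₂ s₂) * (J((d : ℤ) | r₁ * r₂) : ℂ) *
            (g |(s₁ : ℝ) / r₁ - (s₂ : ℝ) / r₂| : ℂ) else 0) =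
      ∑ d ∈ Ioc 0 N, (fun d : ℕ => (F ((d : ℝ) / D) : ℂ)) d *
      ∑ r₁ ∈ Ioc R (2 * R), ∑ s₁ ∈ Ioc S (2 * S), ∑ r₂ ∈ Ioc R (2 * R), ∑ s₂ ∈ Ioc S (2 * S),
        (if r₁ ≠ r₂ ∧ (d : ℤ) ∣ (r₁ : ℤ) * s₂ - (r₂ : ℤ) * s₁ then
          (J((d : ℤ) | r₁ * r₂) : ℂ) * Φ r₁ s₁ r₂ s₂ else 0) := by
    refine sum_congr rfl fun d _ => ?_
    congr 1
    refine sum_congr rfl fun r₁ hr₁ => sum_congr rfl fun s₁ _ => sum_congr rfl fun r₂ hr₂ =>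
      sum_congr rfl fun s₂ _ => ?_
    split_ifs with h
    · rw [hΦ]
      simp only
      by_cases hΔ : (r₁ : ℤ) * s₂ - (r₂ : ℤ) * s₁ = 0
      · rw [if_pos hΔ]
        have hr₁0 : (0 : ℝ) < r₁ := by exact_mod_cast lt_of_le_of_lt (Nat.zero_le _) (mem_Ioc.mp hr₁).1
        have hr₂0 : (0 : ℝ) < r₂ := by exact_mod_cast lt_of_le_of_lt (Nat.zero_le _) (mem_Ioc.mp hr₂).1
        have hx : (s₁ : ℝ) / r₁ - (s₂ : ℝ) / r₂ = 0 := by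
          have hΔr : (r₁ : ℝ) * s₂ - (r₂ : ℝ) * s₁ = 0 := by exact_mod_cast hΔ
          field_simp
          linarith
        rw [hx, abs_zero, hg00]
        simp
      · rw [if_neg hΔ]
        ring
    · rfl
  -- Step 2: the `gcd`/Möbius reduction
  have hw : ∀ d, N < d → (fun d : ℕ => (F ((d : ℝ) / D) : ℂ)) d = 0 := by
    intro d hd
    have hD0' : (0 : ℝ) < D := by exact_mod_cast hD0
    have h52 : (5 : ℝ) / 2 ≤ (d : ℝ) / D := by
      rw [le_div_iff₀ hD0']
      have : ((3 * D : ℕ) : ℝ) < d := by exact_mod_cast lt_of_le_of_lt hN3 hd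
      push_cast at this
      linarith
    simp only [hF4 _ h52, Complex.ofReal_zero]
  have h2 := sum_ne_eq_sum_gcd_moebius R S N (fun d : ℕ => (F ((d : ℝ) / D) : ℂ)) hw Φ
  rw [h1, h2]
  -- Step 3: triangle inequality over `c, m`, `|μ| ≤ 1`, and the bound for each `V_{cm}`
  refine (norm_sum_le _ _).trans (sum_le_sum fun c hc => ?_)
  refine (norm_sum_le _ _).trans (sum_le_sum fun m hm => ?_)
  have hc1 : 1 ≤ c := (mem_Icc.mp hc).1
  have hcR : c ≤ R := (mem_Icc.mp hc).2
  have hc0 : 0 < c := hc1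
  have hm0 : 0 < m := Nat.pos_of_mem_divisors hm
  rw [norm_mul]
  have hμ : ‖(μ m : ℂ)‖ ≤ 1 := by
    rw [Complex.norm_intCast]
    exact_mod_cast ArithmeticFunction.abs_moebius_le_one
  -- nonnegativity of the bound
  have hS0 : (0 : ℝ) ≤ S := Nat.cast_nonneg S
  have hX0 : 0 ≤ (R : ℝ) / c := by positivity
  have hQ₂1 : (1 : ℝ) ≤ max 1 (24 * b * (R : ℝ) ^ 2 / (c * D)) := le_max_left _ _
  have hlogR : 0 ≤ Real.log (2 * R) := Real.log_nonneg (by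
    have : (1 : ℝ) ≤ R := by exact_mod_cast hR
    linarith)
  have hIM : 0 ≤ ∫ t : ℝ, (1 + |t|) ^ 2 * ‖M t‖ :=
    integral_nonneg fun t => mul_nonneg (by positivity) (norm_nonneg _)
  have hBound0 : 0 ≤ C * (1 + Real.log (max 1 (24 * b * (R : ℝ) ^ 2 / (c * D)))) *
      (((R : ℝ) / c * S / Real.sqrt ((m : ℝ) * (2 * a * (R : ℝ) ^ 2 / (5 * c * D))) *
            Real.log (2 * R) + (R : ℝ) / c * S / Real.sqrt (2 * a * (R : ℝ) ^ 2 / (5 * c * D))) *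
          (∑ t ∈ Ioc (R / c) (2 * R / c), ∑ s ∈ Ioc S (2 * S), ‖β (c * t) s‖ ^ 2) +
        ((m : ℝ) * (max 1 (24 * b * (R : ℝ) ^ 2 / (c * D))) * Real.sqrt ((R : ℝ) / c * S) +
            (R : ℝ) / c * (S : ℝ) ^ (3 / 4 : ℝ) + (S : ℝ) * ((R : ℝ) / c) ^ (3 / 4 : ℝ)) *
          ((R : ℝ) / c * S) ^ ε *
          (∑ t ∈ Ioc (R / c) (2 * R / c), ∑ s ∈ Ioc S (2 * S), (σ 0 t : ℝ) * ‖β (c * t) s‖ ^ 2)) *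
      (K * L ^ 2 * ∫ t : ℝ, (1 + |t|) ^ 2 * ‖M t‖) := by
    refine mul_nonneg (mul_nonneg (mul_nonneg hC.le (by linarith [Real.log_nonneg hQ₂1]))
      (add_nonneg ?_ ?_)) (mul_nonneg (mul_nonneg hK (sq_nonneg L)) hIM)
    · exact mul_nonneg (add_nonneg (mul_nonneg (div_nonneg (mul_nonneg hX0 hS0)
        (Real.sqrt_nonneg _)) hlogR) (div_nonneg (mul_nonneg hX0 hS0) (Real.sqrt_nonneg _)))
        (sum_nonneg fun _ _ => sum_nonneg fun _ _ => sq_nonneg _)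
    · exact mul_nonneg (mul_nonneg (add_nonneg (add_nonneg (mul_nonneg (mul_nonneg
        (Nat.cast_nonneg m) (by linarith)) (Real.sqrt_nonneg _))
        (mul_nonneg hX0 (Real.rpow_nonneg hS0 _))) (mul_nonneg hS0 (Real.rpow_nonneg hX0 _)))
        (Real.rpow_nonneg (mul_nonneg hX0 hS0) _))
        (sum_nonneg fun _ _ => sum_nonneg fun _ _ => mul_nonneg (Nat.cast_nonneg _) (sq_nonneg _))
  rcases Nat.even_or_odd c with hce | hco
  · -- even `c`: every term vanishes since `β` lives on odd `r`
    have hz : ∑ d ∈ Ioc 0 N, (fun d : ℕ => (F ((d : ℝ) / D) : ℂ)) (d * m) *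
        ∑ t₁ ∈ Ioc (R / c) (2 * R / c), ∑ s₁ ∈ Ioc S (2 * S), ∑ t₂ ∈ Ioc (R / c) (2 * R / c),
          ∑ s₂ ∈ Ioc S (2 * S),
          (if ((d * m : ℕ) : ℤ) ∣ (t₁ : ℤ) * s₂ - (t₂ : ℤ) * s₁ ∧ t₁.Coprime t₂ then
            (J(((d * m : ℕ) : ℤ) | t₁ * t₂) : ℂ) * Φ (c * t₁) s₁ (c * t₂) s₂ else 0) = 0 := by
      refine sum_eq_zero fun d _ => ?_
      rw [mul_eq_zero]; right
      refine sum_eq_zero fun t₁ _ => sum_eq_zero fun s₁ _ => sum_eq_zero fun t₂ _ =>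
        sum_eq_zero fun s₂ _ => ?_
      split_ifs
      · have hβ0 : β (c * t₁) s₁ = 0 := by
          by_contra h
          exact (Nat.not_even_iff_odd.mpr (hβodd _ _ h)) (hce.mul_right t₁)
        simp [hΦ, hβ0]
      · rfl
    rw [hz, norm_zero, mul_zero]
    exact hBound0
  · -- odd `c`: this is `V_{cm}` as bounded in `exists_norm_flipForm_le`
    have hVcm := hV R S D c m N β F M g a b K L hR hS hD hc1 hcR hco hm0 hN hβ hβ4 hMc hMi hFM hF3
      hF4 hg00 ha hga hgb hĜ
    -- identify the two inner forms (guard in `t`- vs `r`-variables; casts of `c t`)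
    have hid : ∑ d ∈ Ioc 0 N, (fun d : ℕ => (F ((d : ℝ) / D) : ℂ)) (d * m) *
        ∑ t₁ ∈ Ioc (R / c) (2 * R / c), ∑ s₁ ∈ Ioc S (2 * S), ∑ t₂ ∈ Ioc (R / c) (2 * R / c),
          ∑ s₂ ∈ Ioc S (2 * S),
          (if ((d * m : ℕ) : ℤ) ∣ (t₁ : ℤ) * s₂ - (t₂ : ℤ) * s₁ ∧ t₁.Coprime t₂ then
            (J(((d * m : ℕ) : ℤ) | t₁ * t₂) : ℂ) * Φ (c * t₁) s₁ (c * t₂) s₂ else 0) =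
      ∑ d ∈ Ioc 0 N, (F (((d * m : ℕ) : ℝ) / D) : ℂ) *
        ∑ t₁ ∈ Ioc (R / c) (2 * R / c), ∑ s₁ ∈ Ioc S (2 * S), ∑ t₂ ∈ Ioc (R / c) (2 * R / c),
          ∑ s₂ ∈ Ioc S (2 * S),
          (if ((d * m : ℕ) : ℤ) ∣ (t₁ : ℤ) * s₂ - (t₂ : ℤ) * s₁ ∧ t₁.Coprime t₂ then
            (J(((d * m : ℕ) : ℤ) | t₁ * t₂) : ℂ) *
              (β (c * t₁) s₁ * conj (β (c * t₂) s₂) *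
                (if (t₁ : ℤ) * s₂ - (t₂ : ℤ) * s₁ = 0 then (0 : ℂ) else
                  (g |(s₁ : ℝ) / (c * t₁) - (s₂ : ℝ) / (c * t₂)| : ℂ))) else 0) := by
      refine sum_congr rfl fun d _ => ?_
      congr 1
      refine sum_congr rfl fun t₁ _ => sum_congr rfl fun s₁ _ => sum_congr rfl fun t₂ _ =>
        sum_congr rfl fun s₂ _ => ?_
      have hguard : ((c * t₁ : ℕ) : ℤ) * s₂ - ((c * t₂ : ℕ) : ℤ) * s₁ = 0 ↔
          (t₁ : ℤ) * s₂ - (t₂ : ℤ) * s₁ = 0 := by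
        have hc0' : (c : ℤ) ≠ 0 := by exact_mod_cast hc0.ne'
        constructor
        · intro h0
          push_cast at h0
          have : (c : ℤ) * ((t₁ : ℤ) * s₂ - (t₂ : ℤ) * s₁) = 0 := by linear_combination h0
          exact (mul_eq_zero.mp this).resolve_left hc0'
        · intro h0
          push_cast
          linear_combination (c : ℤ) * h0
      have hcast : |(s₁ : ℝ) / ((c * t₁ : ℕ) : ℝ) - (s₂ : ℝ) / ((c * t₂ : ℕ) : ℝ)| =
          |(s₁ : ℝ) / (c * t₁) - (s₂ : ℝ) / (c * t₂)| := by push_cast; ring_nf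
      split_ifs with h hΔ
      · rw [hΦ]
        simp only
        rw [if_pos (hguard.mpr hΔ)]
      · rw [hΦ]
        simp only
        rw [if_neg (fun h0 => hΔ (hguard.mp h0)), hcast]
      · rfl
    rw [hid]
    calc ‖(μ m : ℂ)‖ * _ ≤ 1 * _ := mul_le_mul_of_nonneg_right hμ (norm_nonneg _)
      _ = _ := one_mul _
      _ ≤ _ := hVcm

end Literature.NumberTheory.Sieve.FriedlanderIwaniecPrimes
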